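import Literature.Analysis.FluidPDE.ElgindiHkClosure
import Literature.Analysis.FluidPDE.ElgindiAngularHardyGamma
import Literature.Analysis.FluidPDE.ElgindiSinRpowIntegral
import Literature.Analysis.FluidPDE.ElgindiL12Corrector
import HarnessLib

/-!
# `θ`-constant data have finite `𝓗⁴` functional but are not `𝓗⁴`-limits of test functions
(the closure class of [Elgindi2021] Remark 8.3 is strictly smaller than `{|f|_{𝓗⁴} < ∞}`)

Topic `Literature/Analysis/FluidPDE`. Support file (definitions with bodies and proved theorems, no
named facts) on the proof path of the named fact
`Literature.Analysis.FluidPDE.Elgindi.ElgindiGhoulMasmoudi2021_stabilityCore`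
(`ElgindiStabilityDecomposition.lean`). T. M. Elgindi, Ann. of Math. 194 (2021) =
arXiv:1904.04795, §1.7.2 (the weights: `sin(2θ)^{−η/2}` with `η = 99/100` on the radial terms,
`sin(2θ)^{−γ/2}` with `γ = 1 + α/10 > 1` on the terms with `θ`-derivatives) and §8.1 Remark 8.3
("it suffices to prove the inequality for `C_c^∞` functions"); [ElgindiGhoulMasmoudi2021] §1.7,
§9 Lemma 9.1.

Since `η < 1 < γ`, a function `F₀(R, θ) = φ(R)` constant in `θ` (`φ` smooth, compactly supported
in `(0,∞)`) has a finite `𝓗⁴` functional (`eHkNormSq_tensor_one_lt_top`): all `D_θ`-words vanish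
and `∫₀^{π/2} sin(2θ)^{−η}dθ < ∞`. But by the `γ`-Hardy inequality for test functions
(`lintegral_sq_rpow_neg_gamma_le`) every test function `f` of the open strip satisfies
`∫∫_{θ ∈ (π/8,π/4)} w²φ²sin(2θ)^{−γ} ≤ K·|f − F₀|²_{𝓗⁴}` with `K` depending only on `α`
(`lintegral_box_le_mul_eHkNormSq_sub`), so `F₀` is at positive `𝓗⁴`-distance from the test
functions and is not in the closure class `HkApprox` whenever `φ ≢ 0` (`not_hkApprox_tensor_one`).
This makes precise the function-space caveat recorded for the stability theorem: the printed
proofs (Lemma 9.1-based sup bounds, product and transport rules) apply on the closure of the test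
functions, not on all of `{|ε₀|_{𝓗⁴} < ∞}`.
-/

noncomputable section

open MeasureTheory Set Function Real Filter
open _root_.Topology
open scoped ENNReal ContDiff

namespace Literature.Analysis.FluidPDE

namespace Elgindi

/-! ### `θ`-constant functions and their words -/

/-- `D_θ₁` kills constants. [folklore] -/
theorem Dθ₁_constFun (c : ℝ) : Dθ₁ (fun _ : ℝ => c) = fun _ => 0 := by
  funext θ; simp [Dθ₁]

/-- `D_θ₁^{i+1}` kills constants. [folklore] -/
theorem iterate_Dθ₁_constFun_succ (c : ℝ) (i : ℕ) : Dθ₁^[i + 1] (fun _ : ℝ => c) = fun _ => 0 := by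
  induction i with
  | zero => simpa using Dθ₁_constFun c
  | succ i ih => rw [Function.iterate_succ_apply', ih, Dθ₁_constFun]

/-- The words of a `θ`-constant function: `D_θ^iD_R^j(φ ⊗ 1) = (D_R^jφ) ⊗ 1` for `i = 0` and `0` for `i ≥ 1`. [folklore] -/
theorem word_tensor_one (φ : ℝ → ℝ) (i j : ℕ) (z θ : ℝ) :
    (Dθ^[i] (Dz^[j] (tensor φ fun _ => (1:ℝ)))) z θ = if i = 0 then (Dz₁^[j] φ) z else 0 := by
  rw [iterate_Dθ_Dz_tensor, tensor_apply]
  split_ifs with hi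
  · subst hi; simp
  · obtain ⟨i', rfl⟩ : ∃ i', i = i' + 1 := ⟨i - 1, by omega⟩
    rw [iterate_Dθ₁_constFun_succ]; simp

/-! ### Compact support inside `(0,∞)` -/

/-- `tsupport (D_Rψ) ⊆ tsupport ψ`. [folklore] -/
theorem tsupport_Dz₁_subset (ψ : ℝ → ℝ) : tsupport (Dz₁ ψ) ⊆ tsupport ψ := by
  have h : support (Dz₁ ψ) ⊆ tsupport ψ := fun z hz => by
    rw [mem_support, Dz₁_apply] at hz
    exact support_deriv_subset (mem_support.2 (right_ne_zero_of_mul hz))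
  exact closure_minimal h (isClosed_tsupport _)

/-- `tsupport (D_R^jψ) ⊆ tsupport ψ`. [folklore] -/
theorem tsupport_iterate_Dz₁_subset (ψ : ℝ → ℝ) (j : ℕ) : tsupport (Dz₁^[j] ψ) ⊆ tsupport ψ := by
  induction j with
  | zero => exact subset_rfl
  | succ j ih => rw [Function.iterate_succ_apply']; exact (tsupport_Dz₁_subset _).trans ih

/-- A compact subset of `(0,∞)` lies in some `[a, b]` with `0 < a`. [folklore] -/
theorem exists_Icc_of_compact_subset_Ioi {K : Set ℝ} (hK : IsCompact K) (hKs : K ⊆ Ioi 0) :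
    ∃ a b : ℝ, 0 < a ∧ a ≤ b ∧ K ⊆ Icc a b := by
  by_cases hne : K.Nonempty
  · obtain ⟨x₀, hx₀⟩ := hne
    refine ⟨sInf K, sSup K, hKs (hK.sInf_mem ⟨x₀, hx₀⟩), (csInf_le hK.bddBelow hx₀).trans (le_csSup hK.bddAbove hx₀),
      fun x hx => ⟨csInf_le hK.bddBelow hx, le_csSup hK.bddAbove hx⟩⟩
  · exact ⟨1, 1, one_pos, le_rfl, fun x hx => absurd ⟨x, hx⟩ hne⟩

/-- **The radial energies of a smooth function compactly supported in `(0,∞)` are finite.** [folklore] -/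
theorem radialEnergy_lt_top_of_tsupport {φ : ℝ → ℝ} (hφ : ContDiff ℝ ∞ φ) (hs : HasCompactSupport φ) (hsub : tsupport φ ⊆ Ioi 0) (j : ℕ) :
    radialEnergy j φ < ⊤ := by
  obtain ⟨a, b, ha, hab, hK⟩ := exists_Icc_of_compact_subset_Ioi hs hsub
  set ψ := Dz₁^[j] φ with hψ
  have hψc : Continuous ψ := (contDiff_iterate_Dz₁_infty hφ j).continuous
  have hψK : tsupport ψ ⊆ Icc a b := (tsupport_iterate_Dz₁_subset φ j).trans hK
  -- the integrand vanishes off `[a,b]` and is bounded there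
  have hcont : ContinuousOn (fun R : ℝ => radialWeight R ^ 2 * ψ R ^ 2) (Icc a b) := by
    refine ContinuousOn.mul ?_ (hψc.continuousOn.pow 2)
    unfold radialWeight
    exact (ContinuousOn.div (by fun_prop) (by fun_prop) fun R hR => pow_ne_zero 2 (lt_of_lt_of_le ha hR.1).ne').pow 2
  obtain ⟨M, hM⟩ := (isCompact_Icc (a := a) (b := b)).exists_bound_of_continuousOn hcont
  have h0 : ∀ R, R ∉ Icc a b → radialWeight R ^ 2 * ψ R ^ 2 = 0 := fun R hR => by
    have : ψ R = 0 := image_eq_zero_of_notMem_tsupport fun h => hR (hψK h)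
    rw [this]; ring
  unfold radialEnergy
  calc ∫⁻ R in Ioi 0, ENNReal.ofReal (radialWeight R ^ 2 * (Dz₁^[j] φ) R ^ 2)
      ≤ ∫⁻ R in Ioi 0, (Icc a b).indicator (fun _ => ENNReal.ofReal M) R := by
        refine lintegral_mono fun R => ?_
        by_cases hR : R ∈ Icc a b
        · rw [indicator_of_mem hR]
          refine ENNReal.ofReal_le_ofReal ?_
          have := hM R hR; rw [Real.norm_eq_abs] at this
          exact (le_abs_self _).trans this
        · rw [indicator_of_notMem hR, show (Dz₁^[j] φ) R = ψ R from rfl, h0 R hR, ENNReal.ofReal_zero]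
    _ = ENNReal.ofReal M * volume (Icc a b ∩ Ioi 0) := by
        rw [lintegral_indicator measurableSet_Icc, setLIntegral_const, Measure.restrict_apply measurableSet_Icc]
    _ < ⊤ := ENNReal.mul_lt_top ENNReal.ofReal_lt_top ((measure_mono inter_subset_left).trans_lt (by rw [Real.volume_Icc]; exact ENNReal.ofReal_lt_top))

/-! ### The `𝓗⁴` functional of a `θ`-constant function is finite -/

/-- `hWeight² = w²·sin(2θ)^{−η}` on the strip. [folklore] -/
theorem hWeight_sq_eq {p : ℝ × ℝ} (hp : p ∈ strip) : hWeight p.1 p.2 ^ 2 = radialWeight p.1 ^ 2 * Real.sin (2 * p.2) ^ (-eta) := by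
  have hs : 0 < Real.sin (2 * p.2) := Real.sin_pos_of_pos_of_lt_pi (by linarith [hp.2.1]) (by linarith [hp.2.2])
  unfold hWeight
  rw [div_pow, ← Real.rpow_natCast (Real.sin (2 * p.2) ^ (eta / 2)) 2, ← Real.rpow_mul hs.le, Real.rpow_neg hs.le]
  norm_num
  rw [div_eq_mul_inv]

/-- **A `θ`-constant function with `φ` smooth and compactly supported in `(0,∞)` has a finite `𝓗⁴`
functional** (`η = 99/100 < 1`). [cite: Elgindi2021, §1.7.2 (p. 7 of arXiv:1904.04795): the weights of the 𝓗ᵏ norm] -/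
theorem eHkNormSq_tensor_one_lt_top (α : ℝ) {φ : ℝ → ℝ} (hφ : ContDiff ℝ ∞ φ) (hs : HasCompactSupport φ) (hsub : tsupport φ ⊆ Ioi 0) :
    eHkNormSq α 4 (tensor φ fun _ => (1:ℝ)) < ⊤ := by
  set F₀ : ℝ → ℝ → ℝ := tensor φ fun _ => (1:ℝ) with hF₀
  -- the angular factor `∫ sin(2θ)^{−η} < ∞`
  have hθ : ∫⁻ θ in Ioo 0 (π / 2), ENNReal.ofReal (Real.sin (2 * θ) ^ (-eta)) < ⊤ := by
    have hi := integrableOn_sin_two_mul_rpow (r := -eta) (by unfold eta; norm_num) (by unfold eta; norm_num)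
    rw [← ofReal_integral_eq_lintegral_ofReal hi ((ae_restrict_iff' measurableSet_Ioo).2 (ae_of_all _ fun θ hθ =>
      Real.rpow_nonneg (Real.sin_pos_of_pos_of_lt_pi (by linarith [hθ.1]) (by linarith [hθ.2])).le _))]
    exact ENNReal.ofReal_lt_top
  -- radial terms
  have hrad : ∀ j, eL2Sq (hkRadialTerm j F₀) < ⊤ := by
    intro j
    have e : eL2Sq (hkRadialTerm j F₀) = ∫⁻ p in strip, ENNReal.ofReal (radialWeight p.1 ^ 2 * (Dz₁^[j] φ) p.1 ^ 2) * ENNReal.ofReal (Real.sin (2 * p.2) ^ (-eta)) := by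
      rw [eL2Sq_eq_lintegral_ofReal]
      refine setLIntegral_congr_fun measurableSet_strip fun p hp => ?_
      have hw := word_tensor_one φ 0 j p.1 p.2
      simp only [Function.iterate_zero, id_eq, if_true] at hw
      simp only [hkRadialTerm]
      rw [hw, mul_pow, hWeight_sq_eq hp, ← ENNReal.ofReal_mul (by positivity)]
      ring_nf
    rw [e, lintegral_strip_tensor (a := fun R => ENNReal.ofReal (radialWeight R ^ 2 * (Dz₁^[j] φ) R ^ 2))
      (b := fun θ => ENNReal.ofReal (Real.sin (2 * θ) ^ (-eta))) ?_ ?_]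
    · exact ENNReal.mul_lt_top (radialEnergy_lt_top_of_tsupport hφ hs hsub j) hθ
    · have hc : ContinuousOn (fun R : ℝ => radialWeight R ^ 2 * (Dz₁^[j] φ) R ^ 2) (Ioi 0) := by
        refine ContinuousOn.mul ?_ (((contDiff_iterate_Dz₁_infty hφ j).continuous.continuousOn).pow 2)
        unfold radialWeight
        exact (ContinuousOn.div (by fun_prop) (by fun_prop) fun R hR => pow_ne_zero 2 (ne_of_gt hR)).pow 2
      exact (hc.aemeasurable measurableSet_Ioi).ennreal_ofReal
    · exact (Measurable.ennreal_ofReal ((by fun_prop : Measurable fun θ : ℝ => Real.sin (2 * θ)).pow_const _)).aemeasurable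
  -- mixed terms vanish
  have hmix : ∀ i j, 1 ≤ i → eL2Sq (hkMixedTerm α i j F₀) = 0 := by
    intro i j hi
    have e : hkMixedTerm α i j F₀ = 0 := by
      funext z θ
      have hw := word_tensor_one φ i j z θ
      rw [if_neg (by omega)] at hw
      show (Dθ^[i] (Dz^[j] (tensor φ fun _ => (1:ℝ)))) z θ * totalWeight α z θ = 0
      rw [hw, zero_mul]
    rw [e, eL2Sq_zero]
  unfold eHkNormSq
  refine ENNReal.add_lt_top.2 ⟨?_, ?_⟩
  · exact ENNReal.sum_lt_top.2 fun j _ => hrad j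
  · refine ENNReal.sum_lt_top.2 fun i _ => ENNReal.sum_lt_top.2 fun j _ => ?_
    split_ifs with hc
    · rw [hmix i j hc.1]; exact ENNReal.zero_lt_top
    · exact ENNReal.zero_lt_top

/-! ### The lower bound on the distance to test functions -/

/-- The box where the lower bound lives: `(0,∞) × (π/8, π/4)` (`sin 2θ ≥ √2/2` there). [folklore] -/
def ndBox : Set (ℝ × ℝ) := Ioi 0 ×ˢ Ioo (π / 8) (π / 4)

/-- The box lies in the strip. [folklore] -/
theorem ndBox_subset_strip : ndBox ⊆ strip := fun p hp =>
  ⟨hp.1, ⟨lt_trans (by positivity) hp.2.1, lt_trans hp.2.2 (by linarith [Real.pi_pos])⟩⟩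

/-- The box is measurable. [folklore] -/
theorem measurableSet_ndBox : MeasurableSet ndBox := measurableSet_Ioi.prod measurableSet_Ioo

/-- On the box, `√2/2 ≤ sin 2θ`. [folklore] -/
theorem sqrt_two_div_two_le_sin {p : ℝ × ℝ} (hp : p ∈ ndBox) : Real.sqrt 2 / 2 ≤ Real.sin (2 * p.2) := by
  rw [← Real.sin_pi_div_four]
  exact Real.sin_le_sin_of_le_of_le_pi_div_two (by linarith [Real.pi_pos]) (by linarith [hp.2.2]) (by linarith [hp.2.1])

/-- **The lower bound**: for `0 < α ≤ 10`, a test function `f` of the open strip, and `F₀ = φ ⊗ 1`,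
`∫∫_box w²φ(R)²sin(2θ)^{−γ} ≤ K(α)·|f − F₀|²_{𝓗⁴}` with
`K(α) = 2(√2/2)^{η−γ} + 2(π/(γ−1))²`. [cite: Elgindi2021, §8.1 Lemma 8.1 / Remark 8.3 (pp. 25, 27 of arXiv:1904.04795); ElgindiGhoulMasmoudi2021, §9 Lemma 9.1 (p. 19 of arXiv:1910.14071)] -/
theorem lintegral_box_le_mul_eHkNormSq_sub {α : ℝ} (hα : 0 < α) (hα10 : α ≤ 10) {f : ℝ → ℝ → ℝ} (hf : StripTest f) {φ : ℝ → ℝ} (hφc : Continuous φ) :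
    ∫⁻ p in ndBox, ENNReal.ofReal (radialWeight p.1 ^ 2 * φ p.1 ^ 2 * Real.sin (2 * p.2) ^ (-gammaExp α)) ≤
      (2 * ENNReal.ofReal ((Real.sqrt 2 / 2) ^ (eta - gammaExp α)) + 2 * ENNReal.ofReal ((π / (gammaExp α - 1)) ^ 2)) *
        eHkNormSq α 4 (f - tensor φ fun _ => (1:ℝ)) := by
  set F₀ : ℝ → ℝ → ℝ := tensor φ fun _ => (1:ℝ) with hF₀
  set γ := gammaExp α with hγ
  set m : ℝ := Real.sqrt 2 / 2 with hm
  have hm0 : 0 < m := by positivity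
  have hηγ : eta - γ ≤ 0 := by unfold eta gammaExp at *; rw [hγ]; linarith
  -- pointwise: `w²φ²s^{−γ} ≤ 2 w²f²s^{−γ} + 2 m^{η−γ}·((f − F₀)·hW)²` on the box
  have hpt : ∀ p ∈ ndBox, ENNReal.ofReal (radialWeight p.1 ^ 2 * φ p.1 ^ 2 * Real.sin (2 * p.2) ^ (-γ)) ≤
      2 * ENNReal.ofReal ((Real.sqrt 2 / 2) ^ (eta - γ)) * ENNReal.ofReal (((f - F₀) p.1 p.2 * hWeight p.1 p.2) ^ 2) +
        2 * ENNReal.ofReal (radialWeight p.1 ^ 2 * (f p.1 p.2) ^ 2 * Real.sin (2 * p.2) ^ (-γ)) := by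
    intro p hp
    have hps := ndBox_subset_strip hp
    have hs : 0 < Real.sin (2 * p.2) := Real.sin_pos_of_pos_of_lt_pi (by linarith [hps.2.1]) (by linarith [hps.2.2])
    have hsm : m ≤ Real.sin (2 * p.2) := sqrt_two_div_two_le_sin hp
    have hpow : Real.sin (2 * p.2) ^ (eta - γ) ≤ m ^ (eta - γ) := Real.rpow_le_rpow_of_nonpos hm0 hsm hηγ
    have esplit : Real.sin (2 * p.2) ^ (-γ) = Real.sin (2 * p.2) ^ (-eta) * Real.sin (2 * p.2) ^ (eta - γ) := by
      rw [← Real.rpow_add hs]; ring_nf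
    have eF : (f - F₀) p.1 p.2 = f p.1 p.2 - φ p.1 := by simp [hF₀, tensor_apply]
    rw [← ENNReal.ofReal_ofNat 2, ← ENNReal.ofReal_mul (by norm_num), ← ENNReal.ofReal_mul (by positivity), ← ENNReal.ofReal_mul (by norm_num),
      ← ENNReal.ofReal_add (by positivity) (by positivity)]
    refine ENNReal.ofReal_le_ofReal ?_
    rw [eF, mul_pow, hWeight_sq_eq hps, esplit]
    have hw2 : 0 ≤ radialWeight p.1 ^ 2 := sq_nonneg _
    have hse : 0 ≤ Real.sin (2 * p.2) ^ (-eta) := Real.rpow_nonneg hs.le _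
    have hsg : 0 ≤ Real.sin (2 * p.2) ^ (eta - γ) := Real.rpow_nonneg hs.le _
    -- `φ² ≤ 2f² + 2(f − φ)²` and `s^{η−γ} ≤ m^{η−γ}`
    have hsq : φ p.1 ^ 2 ≤ 2 * f p.1 p.2 ^ 2 + 2 * (f p.1 p.2 - φ p.1) ^ 2 := by nlinarith [sq_nonneg (2 * f p.1 p.2 - φ p.1)]
    calc radialWeight p.1 ^ 2 * φ p.1 ^ 2 * (Real.sin (2 * p.2) ^ (-eta) * Real.sin (2 * p.2) ^ (eta - γ))
        ≤ radialWeight p.1 ^ 2 * (2 * f p.1 p.2 ^ 2 + 2 * (f p.1 p.2 - φ p.1) ^ 2) * (Real.sin (2 * p.2) ^ (-eta) * Real.sin (2 * p.2) ^ (eta - γ)) := by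
          gcongr
      _ = 2 * (radialWeight p.1 ^ 2 * f p.1 p.2 ^ 2 * (Real.sin (2 * p.2) ^ (-eta) * Real.sin (2 * p.2) ^ (eta - γ))) +
            2 * ((f p.1 p.2 - φ p.1) ^ 2 * (radialWeight p.1 ^ 2 * Real.sin (2 * p.2) ^ (-eta))) * Real.sin (2 * p.2) ^ (eta - γ) := by ring
      _ ≤ 2 * (radialWeight p.1 ^ 2 * f p.1 p.2 ^ 2 * (Real.sin (2 * p.2) ^ (-eta) * Real.sin (2 * p.2) ^ (eta - γ))) +
            2 * ((f p.1 p.2 - φ p.1) ^ 2 * (radialWeight p.1 ^ 2 * Real.sin (2 * p.2) ^ (-eta))) * m ^ (eta - γ) := by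
          gcongr
      _ = 2 * (Real.sqrt 2 / 2) ^ (eta - γ) * ((f p.1 p.2 - φ p.1) ^ 2 * (radialWeight p.1 ^ 2 * Real.sin (2 * p.2) ^ (-eta))) +
            2 * (radialWeight p.1 ^ 2 * f p.1 p.2 ^ 2 * (Real.sin (2 * p.2) ^ (-eta) * Real.sin (2 * p.2) ^ (eta - γ))) := by rw [hm]; ring
  -- integrate over the box, then over the strip
  have hcX : ContinuousOn (fun p : ℝ × ℝ => ((f - F₀) p.1 p.2 * hWeight p.1 p.2) ^ 2) strip := by
    refine (ContinuousOn.mul ?_ continuousOn_hWeight).pow 2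
    have e : (fun p : ℝ × ℝ => (f - F₀) p.1 p.2) = fun p => f p.1 p.2 - φ p.1 := by funext p; simp [hF₀, tensor_apply]
    rw [e]
    exact (((hf.smooth 0).continuous).sub (hφc.comp continuous_fst)).continuousOn
  have mX : AEMeasurable (fun p : ℝ × ℝ => ENNReal.ofReal (((f - F₀) p.1 p.2 * hWeight p.1 p.2) ^ 2)) (volume.restrict ndBox) :=
    ((hcX.mono ndBox_subset_strip).aemeasurable measurableSet_ndBox).ennreal_ofReal
  have hX : ∫⁻ p in strip, ENNReal.ofReal (((f - F₀) p.1 p.2 * hWeight p.1 p.2) ^ 2) ≤ eHkNormSq α 4 (f - F₀) := by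
    refine le_trans (le_of_eq ?_) (eL2Sq_hkRadialTerm_le α (show 0 ≤ 4 by norm_num) (f - F₀))
    rw [eL2Sq_eq_lintegral_ofReal]
    rfl
  have hY : ∫⁻ p in strip, ENNReal.ofReal (radialWeight p.1 ^ 2 * (f p.1 p.2) ^ 2 * Real.sin (2 * p.2) ^ (-γ)) ≤
      ENNReal.ofReal ((π / (γ - 1)) ^ 2) * eHkNormSq α 4 (f - F₀) := by
    refine (lintegral_sq_rpow_neg_gamma_le hα hα10 hf).trans (mul_le_mul_right ?_ _)
    have e : hkMixedTerm α 1 0 f = hkMixedTerm α 1 0 (f - F₀) := by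
      funext z θ
      simp only [hkMixedTerm, Function.iterate_one, Function.iterate_zero, id_eq, Dθ_eq_mul_dθ, dθ, hF₀, Pi.sub_apply, tensor_apply,
        mul_one, deriv_sub_const]
    rw [e]
    exact eL2Sq_hkMixedTerm_le α (k := 4) (i := 1) (j := 0) le_rfl (by norm_num) (f - F₀)
  calc ∫⁻ p in ndBox, ENNReal.ofReal (radialWeight p.1 ^ 2 * φ p.1 ^ 2 * Real.sin (2 * p.2) ^ (-γ))
      ≤ ∫⁻ p in ndBox, (2 * ENNReal.ofReal ((Real.sqrt 2 / 2) ^ (eta - γ)) * ENNReal.ofReal (((f - F₀) p.1 p.2 * hWeight p.1 p.2) ^ 2) +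
          2 * ENNReal.ofReal (radialWeight p.1 ^ 2 * (f p.1 p.2) ^ 2 * Real.sin (2 * p.2) ^ (-γ))) := setLIntegral_mono' measurableSet_ndBox hpt
    _ = 2 * ENNReal.ofReal ((Real.sqrt 2 / 2) ^ (eta - γ)) * (∫⁻ p in ndBox, ENNReal.ofReal (((f - F₀) p.1 p.2 * hWeight p.1 p.2) ^ 2)) +
          2 * (∫⁻ p in ndBox, ENNReal.ofReal (radialWeight p.1 ^ 2 * (f p.1 p.2) ^ 2 * Real.sin (2 * p.2) ^ (-γ))) := by
        rw [lintegral_add_left' (mX.const_mul _), lintegral_const_mul'' _ mX, lintegral_const_mul' _ _ ENNReal.ofNat_ne_top]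
    _ ≤ 2 * ENNReal.ofReal ((Real.sqrt 2 / 2) ^ (eta - γ)) * eHkNormSq α 4 (f - F₀) + 2 * (ENNReal.ofReal ((π / (γ - 1)) ^ 2) * eHkNormSq α 4 (f - F₀)) :=
        add_le_add (mul_le_mul_right ((lintegral_mono_set ndBox_subset_strip).trans hX) _)
          (mul_le_mul_right ((lintegral_mono_set ndBox_subset_strip).trans hY) _)
    _ = _ := by ring

/-- `1 ≤ w(R)` for `R > 0`. [folklore] -/
theorem one_le_radialWeight' {R : ℝ} (hR : 0 < R) : 1 ≤ radialWeight R := by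
  unfold radialWeight; rw [le_div_iff₀ (by positivity)]; nlinarith

/-- **Non-density**: for `0 < α ≤ 10` and `φ` continuous with `φ(R₀) ≠ 0` at some `R₀ > 0`, the
`θ`-constant function `F₀ = φ ⊗ 1` is not the `𝓗⁴`-limit of test functions of the open strip
(`¬ HkApprox α F₀ f` for every sequence `f`), although `|F₀|_{𝓗⁴} < ∞` when `φ` is smooth and
compactly supported in `(0,∞)` (`eHkNormSq_tensor_one_lt_top`). [cite: Elgindi2021, §8.1 Remark 8.3 (p. 27 of arXiv:1904.04795); ElgindiGhoulMasmoudi2021, §9 Lemma 9.1 (p. 19 of arXiv:1910.14071)] -/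
theorem not_hkApprox_tensor_one {α : ℝ} (hα : 0 < α) (hα10 : α ≤ 10) {φ : ℝ → ℝ} (hφc : Continuous φ) {R₀ : ℝ} (hR₀ : 0 < R₀)
    (hφR₀ : φ R₀ ≠ 0) (fs : ℕ → ℝ → ℝ → ℝ) : ¬ HkApprox α (tensor φ fun _ => (1:ℝ)) fs := by
  intro hA
  set γ := gammaExp α with hγ
  set I := ∫⁻ p in ndBox, ENNReal.ofReal (radialWeight p.1 ^ 2 * φ p.1 ^ 2 * Real.sin (2 * p.2) ^ (-γ)) with hI
  set K : ℝ≥0∞ := 2 * ENNReal.ofReal ((Real.sqrt 2 / 2) ^ (eta - γ)) + 2 * ENNReal.ofReal ((π / (γ - 1)) ^ 2) with hK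
  have hKtop : K ≠ ⊤ := ENNReal.add_ne_top.2 ⟨ENNReal.mul_ne_top ENNReal.ofNat_ne_top ENNReal.ofReal_ne_top, ENNReal.mul_ne_top ENNReal.ofNat_ne_top ENNReal.ofReal_ne_top⟩
  -- `I ≤ K·|f_n − F₀|² → 0`, hence `I = 0`
  have hbound : ∀ n, I ≤ K * eHkNormSq α 4 (fs n - tensor φ fun _ => (1:ℝ)) := fun n =>
    lintegral_box_le_mul_eHkNormSq_sub hα hα10 (hA.test n) hφc
  have hT : Tendsto (fun n => K * eHkNormSq α 4 (fs n - tensor φ fun _ => (1:ℝ))) atTop (𝓝 0) := by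
    have := ENNReal.Tendsto.const_mul hA.conv (Or.inr hKtop)
    rwa [mul_zero] at this
  have hI0 : I ≤ 0 := ge_of_tendsto' hT hbound
  -- but `I > 0`: `φ² ≥ φ(R₀)²/4` near `R₀`
  have hφsq : 0 < φ R₀ ^ 2 := by positivity
  obtain ⟨δ, hδ, hδφ⟩ : ∃ δ > 0, ∀ R, |R - R₀| < δ → φ R₀ ^ 2 / 4 ≤ φ R ^ 2 := by
    have hc : ContinuousAt (fun R => φ R ^ 2) R₀ := (hφc.pow 2).continuousAt
    have hev := hc.eventually (lt_mem_nhds (show φ R₀ ^ 2 / 4 < φ R₀ ^ 2 by linarith))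
    obtain ⟨δ, hδ, h⟩ := Metric.eventually_nhds_iff.1 hev
    exact ⟨δ, hδ, fun R hR => (h (by rwa [Real.dist_eq])).le⟩
  set δ' := min δ (R₀ / 2) with hδ'
  have hδ'pos : 0 < δ' := lt_min hδ (by linarith)
  set S : Set (ℝ × ℝ) := Ioo (R₀ - δ') (R₀ + δ') ×ˢ Ioo (π / 8) (π / 4) with hS
  have hSB : S ⊆ ndBox := fun p hp => ⟨show 0 < p.1 by have := hp.1.1; have : δ' ≤ R₀ / 2 := min_le_right _ _; linarith, hp.2⟩
  have hlow : ∀ p ∈ S, ENNReal.ofReal (φ R₀ ^ 2 / 4) ≤ ENNReal.ofReal (radialWeight p.1 ^ 2 * φ p.1 ^ 2 * Real.sin (2 * p.2) ^ (-γ)) := by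
    intro p hp
    have hps := ndBox_subset_strip (hSB hp)
    have hs : 0 < Real.sin (2 * p.2) := Real.sin_pos_of_pos_of_lt_pi (by linarith [hps.2.1]) (by linarith [hps.2.2])
    have h1 : 1 ≤ radialWeight p.1 ^ 2 := by nlinarith [one_le_radialWeight' hps.1]
    have h2 : 1 ≤ Real.sin (2 * p.2) ^ (-γ) :=
      Real.one_le_rpow_of_pos_of_le_one_of_nonpos hs (Real.sin_le_one _) (by unfold gammaExp at hγ; rw [hγ]; linarith)
    have h3 : φ R₀ ^ 2 / 4 ≤ φ p.1 ^ 2 := hδφ p.1 (by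
      have := hp.1; rw [abs_lt]; constructor <;> linarith [this.1, this.2, min_le_left δ (R₀ / 2)])
    refine ENNReal.ofReal_le_ofReal ?_
    calc φ R₀ ^ 2 / 4 ≤ φ p.1 ^ 2 := h3
      _ = 1 * φ p.1 ^ 2 * 1 := by ring
      _ ≤ radialWeight p.1 ^ 2 * φ p.1 ^ 2 * Real.sin (2 * p.2) ^ (-γ) := by gcongr
  have hIpos : 0 < I := by
    have hvol : 0 < volume S := by
      rw [hS, Measure.volume_eq_prod, Measure.prod_prod, Real.volume_Ioo, Real.volume_Ioo]
      refine ENNReal.mul_pos (ENNReal.ofReal_pos.2 (by linarith)).ne' (ENNReal.ofReal_pos.2 (by linarith [Real.pi_pos])).ne'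
    calc (0:ℝ≥0∞) < ENNReal.ofReal (φ R₀ ^ 2 / 4) * volume S := ENNReal.mul_pos (ENNReal.ofReal_pos.2 (by positivity)).ne' hvol.ne'
      _ = ∫⁻ _ in S, ENNReal.ofReal (φ R₀ ^ 2 / 4) := by rw [setLIntegral_const]
      _ ≤ ∫⁻ p in S, ENNReal.ofReal (radialWeight p.1 ^ 2 * φ p.1 ^ 2 * Real.sin (2 * p.2) ^ (-γ)) :=
          setLIntegral_mono' (measurableSet_Ioo.prod measurableSet_Ioo) hlow
      _ ≤ I := lintegral_mono_set hSB
  exact absurd hI0 (not_le.2 hIpos)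

end Elgindi

end Literature.Analysis.FluidPDE
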